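import Summits.QuantumFields.QCD.Theorems.PauliWegnerSeaFMClosureUnquenchedTwoStarC1Aux2
import Literature.MathematicalPhysics.QuantumLattice.WilsonPropagatorHeavyMass

/-!
# Crux `FMClosureUnquenched` (stmt-QuantumFields-11512), line `von-mises-circles`: K1♭ on the hopping window

**Theorem (`localCofactorDomination_window`).** For every bare mass `m₀` with `41/10 ≤ |m₀ + 4|` (the
convergent-hopping window, both signs of `m₀ + 4`), every odd torus, every gauge field `U`, every site set `A`
and all sites `x, y`: the side matrix `D_A ⊕ 1 = sideMatrix A (wilsonD U m₀)` is invertible and its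
cofactor block is dominated by its OWN determinant,
`Σ_{a,i,b,j} ‖adj(D_A ⊕ 1)_{(x,a,i),(y,b,j)}‖ ≤ 5904 · |det (D_A ⊕ 1)|`.
Hence the registered stub `stub_localCofactorDomination : LocalCofactorDomination` (K1♭) holds on the part
`[-9, -81/10] ∪ [1/10, 1]` of its mass range with `W' := W` (`localCofactorDomination_of_window`), and what
is open of K1♭ is exactly the window `|m₀ + 4| < 41/10` (where the 11510 chain's realisability question lives).

Proof (configuration-wise Neumann series for the SIDE matrix; cf. the tree's
`norm_inv_wilsonDirac_apply_le` for the full operator): with `c = m₀ + 4`, `x = 1 − c⁻¹ D_W`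
(`‖x‖₂ ≤ 4/|c| ≤ 40/41`, four hopping contractions `l2_opNorm_wilsonHop_le`), `P` the diagonal indicator of
the indices over `A` and `Δ = diag(c on A, 1 off A)`, one has `D_A ⊕ 1 = Δ (1 − P x P)` entry by entry,
`‖P x P‖₂ ≤ ‖x‖₂ < 1`, so `D_A ⊕ 1` has the right inverse `(Σ_k (PxP)^k) Δ⁻¹`, whose entries are bounded by
`‖Σ_k (PxP)^k‖₂ · max(|c|⁻¹, 1) ≤ 41`; finally `adj = det · inv` and a block has `144` entries.

References: Montvay–Münster, *Quantum Fields on a Lattice* (CUP 1994) §4.1, §5.1 (hopping parameter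
expansion) [MontvayMunster1994]; Hernández–Jansen–Lüscher, Nucl. Phys. B 552 (1999) 363, (2.13)–(2.14)
[HernandezJansenLuscher1999].
-/

noncomputable section

namespace Summit.QuantumFields.QCD.Theorems.VonMisesCirclesC2B

open scoped BigOperators Matrix.Norms.L2Operator
open Literature.MathematicalPhysics.QuantumFieldTheory Literature.MathematicalPhysics.QuantumLattice
  Literature.Probability.LatticeModels
open Summit.QuantumFields.QCD.Theorems.VonMisesCircles Summit.QuantumFields.QCD.Theorems.VonMisesCirclesC1

variable {N : ℕ} [NeZero N]

/-- `‖1 − (m+4)⁻¹ D_W(m)‖₂ ≤ 4 / |m + 4|` for `m + 4 ≠ 0` (four hopping contractions; the `|·|`-variant of the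
tree's `norm_one_sub_smul_wilsonDirac_le`). [cite: HernandezJansenLuscher1999, (2.14)] -/
theorem norm_one_sub_smul_wilsonD_le (U : GaugeConfig 4 N (Matrix.specialUnitaryGroup (Fin 3) ℂ)) (m : ℝ) (hc : m + 4 ≠ 0) :
    ‖(1 : Matrix (QIdx N) (QIdx N) ℂ) - ((m + 4 : ℝ) : ℂ)⁻¹ • wilsonD U m‖ ≤ 4 / |m + 4| := by
  unfold wilsonD
  rw [one_sub_smul_wilsonDirac_eq (fundamentalRep (Fin 3)) fundamentalRep_mem_unitaryGroup U m hc,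
    norm_smul, norm_inv, Complex.norm_real, Real.norm_eq_abs, div_eq_inv_mul]
  gcongr
  calc ‖∑ μ, wilsonHop (fundamentalRep (Fin 3)) U μ‖
      ≤ ∑ μ, ‖wilsonHop (fundamentalRep (Fin 3)) U μ‖ := norm_sum_le _ _
    _ ≤ ∑ _μ : Fin 4, (1 : ℝ) :=
        Finset.sum_le_sum fun μ _ => l2_opNorm_wilsonHop_le _ fundamentalRep_mem_unitaryGroup U μ
    _ = 4 := by simp

/-- The `ℓ²` operator norm of a diagonal matrix with entries of norm `≤ 1` is `≤ 1`. [folklore] -/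
theorem l2_opNorm_diagonal_le_one {ι : Type*} [Fintype ι] [DecidableEq ι] (v : ι → ℂ)
    (hv : ∀ i, ‖v i‖ ≤ 1) : ‖Matrix.diagonal v‖ ≤ 1 := by
  rw [Matrix.l2_opNorm_diagonal]
  exact (pi_norm_le_iff_of_nonneg zero_le_one).2 hv

/-- **Side matrices on the hopping window: Neumann invertibility and entry bound.**  For `41/10 ≤ |m₀ + 4|`,
every site set `A` and every field, `sideMatrix A (wilsonD U m₀)` has non-zero determinant and all entries of
its inverse have norm `≤ 41`. [cite: MontvayMunster1994, §4.1 and §5.1 (hopping parameter expansion)] -/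
theorem sideMatrix_window_inv_bound (U : GaugeConfig 4 N (Matrix.specialUnitaryGroup (Fin 3) ℂ)) {m₀ : ℝ} (hm : (41 / 10 : ℝ) ≤ |m₀ + 4|)
    (A : Finset (TorusSite 4 N)) :
    (sideMatrix A (wilsonD U m₀)).det ≠ 0 ∧
      ∀ p q : QIdx N, ‖(sideMatrix A (wilsonD U m₀))⁻¹ p q‖ ≤ 41 := by
  classical
  set c : ℝ := m₀ + 4 with hcdef
  have hc0 : c ≠ 0 := by
    intro h; rw [h, abs_zero] at hm; norm_num at hm
  have hcabs : (41 / 10 : ℝ) ≤ |c| := hm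
  have hc' : ((c : ℝ) : ℂ) ≠ 0 := by exact_mod_cast hc0
  -- the hopping part and its norm
  set x : Matrix (QIdx N) (QIdx N) ℂ := 1 - ((c : ℝ) : ℂ)⁻¹ • wilsonD U m₀ with hx
  set θ : ℝ := 4 / |c| with hθ
  have hθ1 : θ ≤ 40 / 41 := by
    rw [hθ, div_le_div_iff₀ (by positivity) (by norm_num)]
    linarith
  have hθ0 : 0 ≤ θ := by positivity
  have hxn : ‖x‖ ≤ θ := norm_one_sub_smul_wilsonD_le U m₀ hc0
  -- the diagonal indicator `P`, the diagonal scaling `Δ` and its inverse `Δi`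
  set P : Matrix (QIdx N) (QIdx N) ℂ := Matrix.diagonal fun q => if q.1 ∈ A then (1 : ℂ) else 0 with hP
  set Δ : Matrix (QIdx N) (QIdx N) ℂ := Matrix.diagonal fun q => if q.1 ∈ A then ((c : ℝ) : ℂ) else 1
    with hΔ
  set Δi : Matrix (QIdx N) (QIdx N) ℂ := Matrix.diagonal fun q => if q.1 ∈ A then ((c : ℝ) : ℂ)⁻¹ else 1
    with hΔi
  set Z : Matrix (QIdx N) (QIdx N) ℂ := P * x * P with hZ
  -- (F1) the side matrix factorises as `Δ (1 − Z)`
  have hPxP : ∀ p q : QIdx N, Z p q =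
      (if p.1 ∈ A then (1 : ℂ) else 0) * x p q * (if q.1 ∈ A then (1 : ℂ) else 0) := by
    intro p q
    rw [hZ, hP, Matrix.mul_diagonal, Matrix.diagonal_mul]
  have hxpq : ∀ p q : QIdx N, x p q =
      (if p = q then (1 : ℂ) else 0) - ((c : ℝ) : ℂ)⁻¹ * wilsonD U m₀ p q := by
    intro p q
    rw [hx, Matrix.sub_apply, Matrix.smul_apply, smul_eq_mul, Matrix.one_apply]
  have hwD : ∀ p : QIdx N, p.1 ∈ A → ∀ q : QIdx N, q.1 ∈ A →
      sideMatrix A (wilsonD U m₀) p q = wilsonD U m₀ p q := by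
    intro p hp q hq
    simp only [sideMatrix, Matrix.of_apply, hp, hq, and_self, if_true]
  have hfac : sideMatrix A (wilsonD U m₀) = Δ * (1 - Z) := by
    ext p q
    rw [hΔ, Matrix.diagonal_mul, Matrix.sub_apply, Matrix.one_apply, hPxP, hxpq]
    by_cases hp : p.1 ∈ A
    · by_cases hq : q.1 ∈ A
      · rw [hwD p hp q hq]
        simp only [hp, hq, if_true, one_mul, mul_one]
        by_cases hpq : p = q
        · simp only [hpq, if_true]
          field_simp
          ring
        · simp only [hpq, if_false]
          field_simp
          ring
      · have hpq : p ≠ q := fun e => hq (e ▸ hp)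
        simp only [sideMatrix, Matrix.of_apply, hp, hq, and_false, if_false, hpq, mul_zero, sub_zero]
    · have h1 : sideMatrix A (wilsonD U m₀) p q = if p = q then 1 else 0 := by
        simp only [sideMatrix, Matrix.of_apply, hp, false_and, if_false]
      rw [h1]
      simp only [hp, if_false, zero_mul, sub_zero, one_mul]
  -- (F2)–(F3) `‖Z‖ ≤ θ < 1`
  have hPn : ‖P‖ ≤ 1 := by
    rw [hP]
    refine l2_opNorm_diagonal_le_one _ fun q => ?_
    split_ifs <;> simp
  have hZn : ‖Z‖ ≤ θ := by
    calc ‖Z‖ ≤ ‖P * x‖ * ‖P‖ := norm_mul_le _ _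
      _ ≤ (‖P‖ * ‖x‖) * ‖P‖ := by gcongr; exact norm_mul_le _ _
      _ ≤ (1 * θ) * 1 := by gcongr
      _ = θ := by ring
  have hZn1 : ‖Z‖ < 1 := by linarith
  -- (F4) the Neumann series of `Z`
  set S : Matrix (QIdx N) (QIdx N) ℂ := ∑' k, Z ^ k with hSdef
  have hS1 : (1 - Z) * S = 1 := mul_neg_geom_series Z hZn1
  -- (F5) `Δ Δi = 1`
  have hΔΔi : Δ * Δi = 1 := by
    rw [hΔ, hΔi, Matrix.diagonal_mul_diagonal, ← Matrix.diagonal_one]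
    congr 1
    funext q
    split_ifs with hq
    · exact mul_inv_cancel₀ hc'
    · exact one_mul 1
  -- (F6) right inverse
  have hinv : sideMatrix A (wilsonD U m₀) * (S * Δi) = 1 := by
    rw [hfac, Matrix.mul_assoc, ← Matrix.mul_assoc (1 - Z), hS1, Matrix.one_mul, hΔΔi]
  have hdet : (sideMatrix A (wilsonD U m₀)).det ≠ 0 := by
    intro h0
    have := congrArg Matrix.det hinv
    rw [Matrix.det_mul, h0, zero_mul, Matrix.det_one] at this
    exact zero_ne_one this
  refine ⟨hdet, fun p q => ?_⟩
  -- (F7) entries of the inverse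
  rw [Matrix.inv_eq_right_inv hinv]
  have hSnorm : ‖S‖ ≤ (1 - θ)⁻¹ := by
    refine (tsum_geometric_le_of_norm_lt_one Z hZn1).trans ?_
    have h1 : ‖(1 : Matrix (QIdx N) (QIdx N) ℂ)‖ ≤ 1 := by
      rw [Matrix.cstar_norm_def, map_one]
      exact ContinuousLinearMap.norm_id_le
    have h2 : (1 - ‖Z‖)⁻¹ ≤ (1 - θ)⁻¹ := inv_anti₀ (by linarith) (by linarith)
    linarith
  have hS41 : ‖S‖ ≤ 41 := by
    refine hSnorm.trans ?_
    rw [inv_le_comm₀ (by linarith) (by norm_num)]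
    linarith
  have hdiag : ‖(if q.1 ∈ A then ((c : ℝ) : ℂ)⁻¹ else 1)‖ ≤ 1 := by
    split_ifs with hq
    · rw [norm_inv, Complex.norm_real, Real.norm_eq_abs]
      exact inv_le_one_of_one_le₀ (by linarith)
    · simp
  calc ‖(S * Δi) p q‖ = ‖S p q * (if q.1 ∈ A then ((c : ℝ) : ℂ)⁻¹ else 1)‖ := by
          rw [hΔi, Matrix.mul_diagonal]
    _ = ‖S p q‖ * ‖(if q.1 ∈ A then ((c : ℝ) : ℂ)⁻¹ else 1)‖ := norm_mul _ _
    _ ≤ ‖S‖ * 1 := mul_le_mul (norm_apply_le_l2_opNorm S p q) hdiag (norm_nonneg _) (norm_nonneg _)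
    _ ≤ 41 := by linarith

/-- **K1♭ on the hopping window, determinant form** (registered sub-goal `localCofactorDomination_window` of
stmt-QuantumFields-11512): for `41/10 ≤ |m₀ + 4|` the cofactor block of every side matrix is dominated by its own
determinant, `blockNorm (adj (D_A ⊕ 1)) x y ≤ 5904 · |det (D_A ⊕ 1)|`, configuration-wise.
[cite: MontvayMunster1994, §4.1 and §5.1 (hopping parameter expansion)] -/
theorem localCofactorDomination_window : ∀ (m₀ : ℝ), (41 / 10 : ℝ) ≤ |m₀ + 4| →
    ∀ (S : ℕ) (U : GaugeConfig 4 (2 * S + 1) (Matrix.specialUnitaryGroup (Fin 3) ℂ))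
      (A : Finset (TorusSite 4 (2 * S + 1))) (x y : TorusSite 4 (2 * S + 1)),
      (sideMatrix A (wilsonD U m₀)).det ≠ 0 ∧
        blockNorm ((sideMatrix A (wilsonD U m₀)).adjugate) x y ≤
          5904 * ‖(sideMatrix A (wilsonD U m₀)).det‖ := by
  intro m₀ hm S U A x y
  obtain ⟨hdet, hent⟩ := sideMatrix_window_inv_bound U hm A
  refine ⟨hdet, ?_⟩
  have hdn : 0 < ‖(sideMatrix A (wilsonD U m₀)).det‖ := norm_pos_iff.2 hdet
  have hinv : blockNorm (sideMatrix A (wilsonD U m₀))⁻¹ x y ≤ 144 * 41 :=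
    blockNorm_le_of_forall_le _ x y 41 fun a b i j => hent _ _
  have hrel := blockNorm_inv (sideMatrix A (wilsonD U m₀)) x y
  -- `blockNorm M⁻¹ = |det M|⁻¹ · blockNorm (adj M)`
  have : blockNorm ((sideMatrix A (wilsonD U m₀)).adjugate) x y =
      ‖(sideMatrix A (wilsonD U m₀)).det‖ * blockNorm (sideMatrix A (wilsonD U m₀))⁻¹ x y := by
    rw [hrel, ← mul_assoc, mul_inv_cancel₀ hdn.ne', one_mul]
  rw [this]
  nlinarith

/-- **K1♭ restricted to the hopping window** (`W' := W`, `C₀ = 5904`): the part of the registered stub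
`stub_localCofactorDomination : LocalCofactorDomination` with `41/10 ≤ |m₀ + 4|`, i.e. probe masses in
`[-9, -81/10] ∪ [1/10, 1]`; admissibility of the side and membership of `x, y` are not needed. -/
theorem localCofactorDomination_of_window : ∀ (m₀ : ℝ), (41 / 10 : ℝ) ≤ |m₀ + 4| →
    ∀ (S : ℕ) (U : GaugeConfig 4 (2 * S + 1) (Matrix.specialUnitaryGroup (Fin 3) ℂ)) (A : Finset (TorusSite 4 (2 * S + 1)))
      (x y : TorusSite 4 (2 * S + 1)),
      let star : Edge 4 (2 * S + 1) → Prop := fun e =>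
        e.1 = x ∨ Site.shift e.1 e.2 = x ∨ e.1 = y ∨ Site.shift e.1 e.2 = y
      let refit : GaugeConfig 4 (2 * S + 1) (Matrix.specialUnitaryGroup (Fin 3) ℂ) → GaugeConfig 4 (2 * S + 1) (Matrix.specialUnitaryGroup (Fin 3) ℂ) :=
        fun W e => if star e then W e else U e
      ∀ W : GaugeConfig 4 (2 * S + 1) (Matrix.specialUnitaryGroup (Fin 3) ℂ), ∃ W' : GaugeConfig 4 (2 * S + 1) (Matrix.specialUnitaryGroup (Fin 3) ℂ),
        blockNorm ((sideMatrix A (wilsonD (refit W) m₀)).adjugate) x y ≤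
          5904 * ‖(sideMatrix A (wilsonD (refit W') m₀)).det‖ := by
  intro m₀ hm S U A x y star refit W
  exact ⟨W, (localCofactorDomination_window m₀ hm S (refit W) A x y).2⟩

end Summit.QuantumFields.QCD.Theorems.VonMisesCirclesC2B
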